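import Summits.AnomalousDissipation.AnomalousDissipation.Theorems.SolenoidalFractalHomogenisationLagrangianStepSidebandLadderCrushHalfSlot
import HarnessLib

/-!
# K1L_D `stub_D1_V0thg` (stmt-AnomalousDissipation-27980), R3′ lane «SidebandTailCrushing» — file F4h∘F5 (iv): the ν-SCALING of the ladder crush
# (`ν = r³`: window `NearIso 𝔸 (νl) (νh)`, `OddSmall 𝔸 (νβ)` ⇒ rate `lam ≥ c·ν^{2/3}`, crushing factor `exp(−c ν^{2/3} τᵢ/2)` across the half-height window)

Helper file of route `SolenoidalFractalHomogenisation` (`--supports stmt-AnomalousDissipation-27980 --as helper`; one-generation hand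
`leafhand-ad-solenoidalfractalh-1` g0, road E-c, the `ladder_crush_nu` step named in the planner's FINAL HANDOFF (A)).  `ladder_crush_halfslot_nu`:
`Sideband.ladder_crush_halfslot` in the (V)-clause window `lo' = νl`, `hi' = νh`, `βo = νβ` (`l, h > 0`, `β ≥ 0` ν-free), written with the cube
root `r = ν^{1/3} ∈ (0, 1]` as the variable (so that no real powers occur: `ν = r³`), with the choices `ε = r`, `δ₁ = 1/r`, `b = κr`
(`κ³ = 4π²l/(28S₀²)`), `q = 1/√(2S₀)`: the structural constants `S₀ = 4·4a² + 16·8a²(1+m₂)h/l + 1`, `Mo = 8a²(1+m₂)`, `ρ = β/(2l)` are ν-FREE,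
the box condition becomes `C_R ≤ (R − M)·r²` (`C_R = 24κa²/(π²l)`, i.e. truncation radius `R ≳ ν^{−2/3}`), and the four entries of the rate obey
`lam ≥ c·r²` with the explicit ν-free `c = min(2π²l/(21S₀κ²), 4π²la²/(21(1+m₂)), 1/(6K₃), κ/(3K₁))`.  Conclusion (for `2/r ≤ τᵢ`):
`‖u(startᵢ + 3τᵢ/4)‖² ≤ 3(1 + 7S₀κ²/(8π²l))·e^{c}·exp(−c·r²·τᵢ/2)·‖u(startᵢ + τᵢ/4)‖²` — for the quasi-statically stretched slot `τᵢ = τᵢ⁰MB/ν`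
this is the crushing factor `exp(−(c/2)τᵢ⁰MB·ν^{−1/3})` of the R3′ plan memo §4.  Remaining for R3′-2 (not here): the spine
`D1TailCrushTable/Bound/Cert` (periodic response over the path classes of `SidebandPathCensus`, contraction outside the half-height windows).
No definitions, no sorry.  NOT a proof of `stub_D1_V0thg`, of K1L_D or of AD; rung F-D1.A0 infrastructure.
-/

set_option linter.dupNamespace false -- single-conjunct summit: `Summit.AnomalousDissipation.AnomalousDissipation.…` is the mandated namespace

noncomputable section

namespace Summit.AnomalousDissipation.AnomalousDissipation.Theorems.SolenoidalFractalHomogenisation.LagrangianStep.Sideband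

open Set Complex
open scoped InnerProductSpace
open Literature.Analysis Literature.Analysis.FunctionSpaces Literature.Analysis.FunctionSpaces.Torus
open Literature.Analysis.FluidPDE Literature.Analysis.FluidPDE.Torus Literature.Analysis.FluidPDE.LatticeShear

variable {k₀ : ℕ}

/-- Four lower bounds `cᵢ·x ≤ Aᵢ` give `min c₁ (min c₂ (min c₃ c₄))·x ≤ min A₁ (min A₂ (min A₃ A₄))` (`x ≥ 0`). [folklore] -/
theorem min_four_mul_le {c₁ c₂ c₃ c₄ A₁ A₂ A₃ A₄ x : ℝ} (hx : 0 ≤ x)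
    (h1 : c₁ * x ≤ A₁) (h2 : c₂ * x ≤ A₂) (h3 : c₃ * x ≤ A₃) (h4 : c₄ * x ≤ A₄) :
    min c₁ (min c₂ (min c₃ c₄)) * x ≤ min A₁ (min A₂ (min A₃ A₄)) := by
  refine le_min ((mul_le_mul_of_nonneg_right (min_le_left _ _) hx).trans h1) (le_min ?_ (le_min ?_ ?_))
  · exact (mul_le_mul_of_nonneg_right ((min_le_right _ _).trans (min_le_left _ _)) hx).trans h2
  · exact (mul_le_mul_of_nonneg_right (((min_le_right _ _).trans (min_le_right _ _)).trans (min_le_left _ _)) hx).trans h3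
  · exact (mul_le_mul_of_nonneg_right (((min_le_right _ _).trans (min_le_right _ _)).trans (min_le_right _ _)) hx).trans h4

set_option maxHeartbeats 800000 in -- pre-budgeted (ops-buildfix rule): large statement + real-inequality bookkeeping
/-- **ν-SCALING OF THE LADDER CRUSH** (`Sideband.ladder_crush_halfslot` in the window `lo' = r³l`, `hi' = r³h`, `βo = r³β`, `r = ν^{1/3} ∈ (0,1]`,
with `ε = r`, `δ₁ = 1/r`, `b = κr`): rate `≥ c·r²` with `c` ν-free and explicit, crushing factor `exp(−c r² τᵢ/2)` across the half-height window
(see the module docstring for the dictionary). [cite: BedrossianCotiZelati2017, §2 (hypocoercivity, enhanced dissipation)]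
[cite: Avron1998OddViscosity, §2 eq. (1)-(2)] -/
theorem ladder_crush_halfslot_nu (W₁ : LatticeWord k₀) {R : ℕ} (i : Fin k₀) (z₀ : Fin 3 → ℤ)
    (hhop : ∑ a, (W₁.phase i).e a * (z₀ a : ℝ) ≠ 0) {M : ℝ} (hM : ∀ j, |((W₁.phase i).m j : ℝ)| ≤ M) (hMR : M < R)
    {r l h β : ℝ} (hr : 0 < r) (hr1 : r ≤ 1) (hl : 0 < l) (hh : 0 < h) (hβ : 0 ≤ β)
    {𝔸 : Torus.Visc4 (Fin 3)} (h𝔸 : Torus.NearIso 𝔸 (r ^ 3 * l) (r ^ 3 * h)) (hoddA : Torus.OddSmall 𝔸 (r ^ 3 * β)) {γ₁ : ℝ} (hγ₁ : 0 ≤ γ₁)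
    {u : ℝ → Space R} (hτ : 2 / r ≤ (W₁.phase i).τ)
    (hu : ∀ t ∈ Icc (W₁.start i + (W₁.phase i).τ / 4) (W₁.start i + 3 * (W₁.phase i).τ / 4),
      HasDerivAt u (((gen W₁ 𝔸 γ₁ R t).restrictScalars ℝ) (u t)) t)
    (h0 : u (W₁.start i + (W₁.phase i).τ / 4) ∈ ladderSub R (ladder z₀ (W₁.phase i).m))
    -- the ν-free abbreviations (instantiate with `rfl`) and the cube root `κ` of `4π²l/(28S₀²)`
    {a m₂ S₀ Mo κ CR K₁ K₃ c : ℝ} (ha0 : 0 < a)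
    (ha : a = 2 * Real.pi * |∑ a, (W₁.phase i).e a * (z₀ a : ℝ)| * ‖slotAmp W₁ i‖)
    (hm₂ : m₂ = freqNormSq (W₁.phase i).m)
    (hS₀ : S₀ = 4 * (4 * a ^ 2) + 16 * (8 * a ^ 2 * (1 + m₂) * h / l) + 1)
    (hMo : Mo = 8 * a ^ 2 * (1 + m₂)) (hκ0 : 0 < κ) (hκ3 : κ ^ 3 = 4 * Real.pi ^ 2 * l / (28 * S₀ ^ 2))
    (hCR : CR = 24 * κ * a ^ 2 / (Real.pi ^ 2 * l))
    (hK₁ : K₁ = (1 + m₂) / (4 * a ^ 2) * (2 + 2 * a ^ 2))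
    (hK₃ : K₃ = (1 + m₂) / (4 * a ^ 2) * (6 * a ^ 2 / (4 * Real.pi ^ 2 * l * CR) + 4 * a ^ 2 / (4 * Real.pi ^ 2 * l * CR ^ 2)))
    (hc : c = min (2 * Real.pi ^ 2 * l / (21 * S₀ * κ ^ 2)) (min (4 * Real.pi ^ 2 * l * a ^ 2 / (21 * (1 + m₂))) (min (1 / (6 * K₃)) (κ / (3 * K₁)))))
    -- the two environmental conditions: odd-viscosity feasibility and box radius `R − M ≥ C_R ν^{-2/3}`
    (hF : 128 * (β / (2 * l) * (1 + Mo)) ^ 2 ≤ S₀) (hbox : CR ≤ ((R : ℝ) - M) * r ^ 2) :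
    0 < c ∧ ‖u (W₁.start i + 3 * (W₁.phase i).τ / 4)‖ ^ 2 ≤
      3 * (1 + 7 * S₀ * κ ^ 2 / (8 * Real.pi ^ 2 * l)) * Real.exp c * Real.exp (-(c * r ^ 2 * ((W₁.phase i).τ / 2))) *
        ‖u (W₁.start i + (W₁.phase i).τ / 4)‖ ^ 2 := by
  -- positivity
  have hm₂0 : 0 ≤ m₂ := by rw [hm₂]; exact freqNormSq_nonneg _
  have hS₀0 : 0 < S₀ := by rw [hS₀]; positivity
  have hRM : (0:ℝ) < (R : ℝ) - M := sub_pos.mpr hMR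
  have hr3 : 0 < r ^ 3 := by positivity
  have hCR0 : 0 < CR := by rw [hCR]; positivity
  have hK₁0 : 0 < K₁ := by rw [hK₁]; positivity
  have hK₃0 : 0 < K₃ := by rw [hK₃]; positivity
  have hc0 : 0 < c := by rw [hc]; exact lt_min (by positivity) (lt_min (by positivity) (lt_min (by positivity) (by positivity)))
  refine ⟨hc0, ?_⟩
  have hτ0 : 0 < (W₁.phase i).τ := (W₁.phase i).τ_pos
  have h1r : 1 / r ≤ (W₁.phase i).τ / 2 := by
    rw [div_le_div_iff₀ hr two_pos]; rw [div_le_iff₀ hr] at hτ; linarith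
  have hrinv : 1 ≤ 1 / r := by rw [le_div_iff₀ hr]; linarith
  -- the window constants in the `r`-form
  have hhl : |r ^ 3 * h| / (r ^ 3 * l) = h / l := by
    rw [abs_of_pos (by positivity), mul_div_mul_left _ _ hr3.ne']
  have hS : S₀ = 4 * (4 * a ^ 2) + 16 * (8 * a ^ 2 * (1 + m₂) * |r ^ 3 * h| / (r ^ 3 * l)) + 1 := by
    rw [hS₀, mul_div_assoc, mul_div_assoc, hhl]
  have hρ : β / (2 * l) = r ^ 3 * β / (2 * (r ^ 3 * l)) := by
    rw [show 2 * (r ^ 3 * l) = r ^ 3 * (2 * l) by ring, mul_div_mul_left _ _ hr3.ne']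
  have hF' : 128 * (r ^ 3 * β / (2 * (r ^ 3 * l)) * (1 + Mo)) ^ 2 ≤ S₀ := by rw [← hρ]; exact hF
  -- `b = κ r` is the cube root of `lo₁/(4S₀²)`
  set lo₁ : ℝ := 4 * Real.pi ^ 2 * (r ^ 3 * l) / 7 with hlo₁
  have hlo₁0 : 0 < lo₁ := by positivity
  have hbase : lo₁ / (4 * S₀ ^ 2) = (κ * r) ^ 3 := by
    rw [mul_pow, hκ3, hlo₁]; field_simp; ring
  have hb : κ * r = (lo₁ / (4 * S₀ ^ 2)) ^ (1 / 3 : ℝ) := by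
    rw [hbase, one_div, show (3:ℝ) = ((3:ℕ):ℝ) by norm_num, Real.pow_rpow_inv_natCast (by positivity) (by norm_num)]
  have hb0 : 0 < κ * r := by positivity
  -- the box condition ⇒ (Q4)
  have hboxr : CR / r ^ 2 ≤ (R : ℝ) - M := by rw [div_le_iff₀ (by positivity)]; exact hbox
  have Q4 : 16 * (κ * r) * (2 * a ^ 2 * 3 / (((R : ℝ) - M) * (4 * Real.pi ^ 2 * (r ^ 3 * l)))) ≤ 1 := by
    have hden : 0 < ((R : ℝ) - M) * (4 * Real.pi ^ 2 * (r ^ 3 * l)) := by positivity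
    rw [show 16 * (κ * r) * (2 * a ^ 2 * 3 / (((R : ℝ) - M) * (4 * Real.pi ^ 2 * (r ^ 3 * l))))
        = 96 * κ * r * a ^ 2 / (((R : ℝ) - M) * (4 * Real.pi ^ 2 * (r ^ 3 * l))) by ring, div_le_one hden]
    have h1 : 24 * κ * a ^ 2 ≤ ((R : ℝ) - M) * r ^ 2 * (Real.pi ^ 2 * l) := by
      have h := hbox; rw [hCR, div_le_iff₀ (by positivity)] at h; exact h
    calc 96 * κ * r * a ^ 2 = 4 * r * (24 * κ * a ^ 2) := by ring
      _ ≤ 4 * r * (((R : ℝ) - M) * r ^ 2 * (Real.pi ^ 2 * l)) := mul_le_mul_of_nonneg_left h1 (by positivity)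
      _ = ((R : ℝ) - M) * (4 * Real.pi ^ 2 * (r ^ 3 * l)) := by ring
  -- the crush on the half-height window
  obtain ⟨hlam0, hdec⟩ := ladder_crush_halfslot W₁ i z₀ hhop hM hMR h𝔸 (by positivity) (by positivity) hoddA (by positivity) hγ₁
    (one_div_pos.mpr hr) h1r hu h0 ha0 ha hm₂ hlo₁ hS rfl hMo rfl hr rfl rfl rfl hb rfl rfl hF' Q4
  -- the four entries of the rate are `≥ cᵢ r²`
  have hS₀ne : S₀ ≠ 0 := hS₀0.ne'
  have hκne : κ ≠ 0 := hκ0.ne'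
  have hrne : r ≠ 0 := hr.ne'
  have hane : a ≠ 0 := ha0.ne'
  have hlne : l ≠ 0 := hl.ne'
  have hm₂ne : 1 + m₂ ≠ 0 := by positivity
  have hCRne : CR ≠ 0 := hCR0.ne'
  have hRMne : (R : ℝ) - M ≠ 0 := hRM.ne'
  have hr43 : r ^ 4 ≤ r ^ 3 := pow_le_pow_of_le_one hr.le hr1 (by norm_num)
  have hr21 : r ^ 2 ≤ r := pow_le_of_le_one hr.le hr1 two_ne_zero
  have e1 : 2 * Real.pi ^ 2 * l / (21 * S₀ * κ ^ 2) * r ^ 2 ≤ lo₁ / (6 * (S₀ * (κ * r) ^ 2)) := by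
    rw [le_div_iff₀ (by positivity), hlo₁]
    calc 2 * Real.pi ^ 2 * l / (21 * S₀ * κ ^ 2) * r ^ 2 * (6 * (S₀ * (κ * r) ^ 2)) = 4 * Real.pi ^ 2 * l / 7 * r ^ 4 := by
          field_simp
          ring
      _ ≤ 4 * Real.pi ^ 2 * l / 7 * r ^ 3 := mul_le_mul_of_nonneg_left hr43 (by positivity)
      _ = 4 * Real.pi ^ 2 * (r ^ 3 * l) / 7 := by ring
  have e2 : 4 * Real.pi ^ 2 * l * a ^ 2 / (21 * (1 + m₂)) * r ^ 2 ≤ lo₁ / (6 * ((1 + m₂) / (4 * a ^ 2) * (2 * r))) := by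
    rw [le_div_iff₀ (by positivity), hlo₁]
    apply le_of_eq
    field_simp
    ring
  have e3 : 1 / (6 * K₃) * r ^ 2 ≤
      1 / (6 * ((1 + m₂) / (4 * a ^ 2) * (2 * a ^ 2 * 3 / (((R : ℝ) - M) * (4 * Real.pi ^ 2 * (r ^ 3 * l))) +
        4 * a ^ 2 / (4 * Real.pi ^ 2 * (r ^ 3 * l) * ((R : ℝ) - M) ^ 2)))) := by
    -- `U₃ ≤ K₃ / r`
    have hU : (1 + m₂) / (4 * a ^ 2) * (2 * a ^ 2 * 3 / (((R : ℝ) - M) * (4 * Real.pi ^ 2 * (r ^ 3 * l))) +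
        4 * a ^ 2 / (4 * Real.pi ^ 2 * (r ^ 3 * l) * ((R : ℝ) - M) ^ 2)) ≤ K₃ / r := by
      have hpos : (0:ℝ) ≤ (1 + m₂) / (4 * a ^ 2) := by positivity
      have hA : 2 * a ^ 2 * 3 / (((R : ℝ) - M) * (4 * Real.pi ^ 2 * (r ^ 3 * l))) * r ≤ 6 * a ^ 2 / (4 * Real.pi ^ 2 * l * CR) := by
        rw [div_mul_eq_mul_div, div_le_div_iff₀ (by positivity) (by positivity)]
        have h1 : CR * r ≤ ((R : ℝ) - M) * r ^ 2 * r := mul_le_mul_of_nonneg_right hbox hr.le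
        calc 2 * a ^ 2 * 3 * r * (4 * Real.pi ^ 2 * l * CR) = (24 * a ^ 2 * Real.pi ^ 2 * l) * (CR * r) := by ring
          _ ≤ (24 * a ^ 2 * Real.pi ^ 2 * l) * (((R : ℝ) - M) * r ^ 2 * r) := mul_le_mul_of_nonneg_left h1 (by positivity)
          _ = 6 * a ^ 2 * (((R : ℝ) - M) * (4 * Real.pi ^ 2 * (r ^ 3 * l))) := by ring
      have hB : 4 * a ^ 2 / (4 * Real.pi ^ 2 * (r ^ 3 * l) * ((R : ℝ) - M) ^ 2) * r ≤ 4 * a ^ 2 / (4 * Real.pi ^ 2 * l * CR ^ 2) := by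
        rw [div_mul_eq_mul_div, div_le_div_iff₀ (by positivity) (by positivity)]
        have h2 : CR ^ 2 ≤ (((R : ℝ) - M) * r ^ 2) ^ 2 := pow_le_pow_left₀ hCR0.le hbox 2
        have h3 : CR ^ 2 * r ≤ ((R : ℝ) - M) ^ 2 * r ^ 3 := by
          calc CR ^ 2 * r ≤ (((R : ℝ) - M) * r ^ 2) ^ 2 * r := mul_le_mul_of_nonneg_right h2 hr.le
            _ = ((R : ℝ) - M) ^ 2 * (r ^ 4 * r) := by ring
            _ ≤ ((R : ℝ) - M) ^ 2 * (r ^ 3 * 1) :=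
                mul_le_mul_of_nonneg_left (mul_le_mul hr43 hr1 hr.le (by positivity)) (sq_nonneg _)
            _ = ((R : ℝ) - M) ^ 2 * r ^ 3 := by ring
        calc 4 * a ^ 2 * r * (4 * Real.pi ^ 2 * l * CR ^ 2) = (16 * a ^ 2 * Real.pi ^ 2 * l) * (CR ^ 2 * r) := by ring
          _ ≤ (16 * a ^ 2 * Real.pi ^ 2 * l) * (((R : ℝ) - M) ^ 2 * r ^ 3) := mul_le_mul_of_nonneg_left h3 (by positivity)
          _ = 4 * a ^ 2 * (4 * Real.pi ^ 2 * (r ^ 3 * l) * ((R : ℝ) - M) ^ 2) := by ring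
      rw [le_div_iff₀ hr, hK₃]
      calc _ = (1 + m₂) / (4 * a ^ 2) * (2 * a ^ 2 * 3 / (((R : ℝ) - M) * (4 * Real.pi ^ 2 * (r ^ 3 * l))) * r +
            4 * a ^ 2 / (4 * Real.pi ^ 2 * (r ^ 3 * l) * ((R : ℝ) - M) ^ 2) * r) := by ring
        _ ≤ (1 + m₂) / (4 * a ^ 2) * (6 * a ^ 2 / (4 * Real.pi ^ 2 * l * CR) + 4 * a ^ 2 / (4 * Real.pi ^ 2 * l * CR ^ 2)) :=
            mul_le_mul_of_nonneg_left (add_le_add hA hB) hpos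
    have hU0 : 0 < (1 + m₂) / (4 * a ^ 2) * (2 * a ^ 2 * 3 / (((R : ℝ) - M) * (4 * Real.pi ^ 2 * (r ^ 3 * l))) +
        4 * a ^ 2 / (4 * Real.pi ^ 2 * (r ^ 3 * l) * ((R : ℝ) - M) ^ 2)) := by positivity
    calc 1 / (6 * K₃) * r ^ 2 ≤ 1 / (6 * K₃) * r := mul_le_mul_of_nonneg_left hr21 (by positivity)
      _ = 1 / (6 * (K₃ / r)) := by field_simp
      _ ≤ _ := by
          apply one_div_le_one_div_of_le (by positivity)
          exact mul_le_mul_of_nonneg_left hU (by norm_num)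
  have e4 : κ / (3 * K₁) * r ^ 2 ≤ κ * r / (3 * ((1 + m₂) / (4 * a ^ 2) * (2 + 2 * a ^ 2 / r))) := by
    have hU : (1 + m₂) / (4 * a ^ 2) * (2 + 2 * a ^ 2 / r) ≤ K₁ / r := by
      have hpos : (0:ℝ) ≤ (1 + m₂) / (4 * a ^ 2) := by positivity
      rw [le_div_iff₀ hr, hK₁]
      have e : (2 + 2 * a ^ 2 / r) * r = 2 * r + 2 * a ^ 2 := by
        rw [add_mul, div_mul_cancel₀ _ hrne]
      calc _ = (1 + m₂) / (4 * a ^ 2) * ((2 + 2 * a ^ 2 / r) * r) := by ring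
        _ = (1 + m₂) / (4 * a ^ 2) * (2 * r + 2 * a ^ 2) := by rw [e]
        _ ≤ (1 + m₂) / (4 * a ^ 2) * (2 + 2 * a ^ 2) := mul_le_mul_of_nonneg_left (by linarith) hpos
    have hU0 : 0 < (1 + m₂) / (4 * a ^ 2) * (2 + 2 * a ^ 2 / r) := by positivity
    calc κ / (3 * K₁) * r ^ 2 = κ * r / (3 * (K₁ / r)) := by field_simp
      _ ≤ _ := by
          apply div_le_div_of_nonneg_left (by positivity) (by positivity)
          exact mul_le_mul_of_nonneg_left hU (by norm_num)
  have hlamc : c * r ^ 2 ≤ min (lo₁ / (6 * (S₀ * (κ * r) ^ 2))) (min (lo₁ / (6 * ((1 + m₂) / (4 * a ^ 2) * (2 * r))))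
      (min (1 / (6 * ((1 + m₂) / (4 * a ^ 2) * (2 * a ^ 2 * 3 / (((R : ℝ) - M) * (4 * Real.pi ^ 2 * (r ^ 3 * l))) +
        4 * a ^ 2 / (4 * Real.pi ^ 2 * (r ^ 3 * l) * ((R : ℝ) - M) ^ 2)))))
        (κ * r / (3 * ((1 + m₂) / (4 * a ^ 2) * (2 + 2 * a ^ 2 / r)))))) := by
    rw [hc]; exact min_four_mul_le (sq_nonneg r) e1 e2 e3 e4
  -- the prefactor is ν-free with `δ₁ = 1/r`
  have hpre : S₀ * (κ * r) ^ 2 / (2 * (1 / r) * lo₁) = 7 * S₀ * κ ^ 2 / (8 * Real.pi ^ 2 * l) := by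
    rw [hlo₁]; field_simp; ring
  -- the exponent
  have hexp : Real.exp (-(min (lo₁ / (6 * (S₀ * (κ * r) ^ 2))) (min (lo₁ / (6 * ((1 + m₂) / (4 * a ^ 2) * (2 * r))))
      (min (1 / (6 * ((1 + m₂) / (4 * a ^ 2) * (2 * a ^ 2 * 3 / (((R : ℝ) - M) * (4 * Real.pi ^ 2 * (r ^ 3 * l))) +
        4 * a ^ 2 / (4 * Real.pi ^ 2 * (r ^ 3 * l) * ((R : ℝ) - M) ^ 2)))))
        (κ * r / (3 * ((1 + m₂) / (4 * a ^ 2) * (2 + 2 * a ^ 2 / r)))))) * ((W₁.phase i).τ / 2 - 1 / r)))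
      ≤ Real.exp c * Real.exp (-(c * r ^ 2 * ((W₁.phase i).τ / 2))) := by
    rw [← Real.exp_add]
    apply Real.exp_le_exp.mpr
    have hwin : 0 ≤ (W₁.phase i).τ / 2 - 1 / r := sub_nonneg.mpr h1r
    have h1 := mul_le_mul_of_nonneg_right hlamc hwin
    have h2 : c * r ^ 2 * (1 / r) = c * r := by
      rw [pow_two, mul_assoc, mul_assoc, mul_one_div_cancel hrne, mul_one]
    have h4 : c * r ^ 2 * ((W₁.phase i).τ / 2 - 1 / r) = c * r ^ 2 * ((W₁.phase i).τ / 2) - c * r := by rw [mul_sub, h2]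
    have h3 : c * r ≤ c := mul_le_of_le_one_right hc0.le hr1
    rw [h4] at h1
    linarith [h1, h3]
  -- assemble
  have hA : 0 ≤ 3 * (1 + 7 * S₀ * κ ^ 2 / (8 * Real.pi ^ 2 * l)) := by positivity
  calc ‖u (W₁.start i + 3 * (W₁.phase i).τ / 4)‖ ^ 2
      ≤ 3 * (1 + S₀ * (κ * r) ^ 2 / (2 * (1 / r) * lo₁)) * Real.exp (-(min (lo₁ / (6 * (S₀ * (κ * r) ^ 2))) (min (lo₁ / (6 * ((1 + m₂) / (4 * a ^ 2) * (2 * r))))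
      (min (1 / (6 * ((1 + m₂) / (4 * a ^ 2) * (2 * a ^ 2 * 3 / (((R : ℝ) - M) * (4 * Real.pi ^ 2 * (r ^ 3 * l))) +
        4 * a ^ 2 / (4 * Real.pi ^ 2 * (r ^ 3 * l) * ((R : ℝ) - M) ^ 2)))))
        (κ * r / (3 * ((1 + m₂) / (4 * a ^ 2) * (2 + 2 * a ^ 2 / r)))))) * ((W₁.phase i).τ / 2 - 1 / r))) *
          ‖u (W₁.start i + (W₁.phase i).τ / 4)‖ ^ 2 := hdec
    _ = 3 * (1 + 7 * S₀ * κ ^ 2 / (8 * Real.pi ^ 2 * l)) * Real.exp (-(min (lo₁ / (6 * (S₀ * (κ * r) ^ 2))) (min (lo₁ / (6 * ((1 + m₂) / (4 * a ^ 2) * (2 * r))))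
      (min (1 / (6 * ((1 + m₂) / (4 * a ^ 2) * (2 * a ^ 2 * 3 / (((R : ℝ) - M) * (4 * Real.pi ^ 2 * (r ^ 3 * l))) +
        4 * a ^ 2 / (4 * Real.pi ^ 2 * (r ^ 3 * l) * ((R : ℝ) - M) ^ 2)))))
        (κ * r / (3 * ((1 + m₂) / (4 * a ^ 2) * (2 + 2 * a ^ 2 / r)))))) * ((W₁.phase i).τ / 2 - 1 / r))) *
          ‖u (W₁.start i + (W₁.phase i).τ / 4)‖ ^ 2 := by rw [hpre]
    _ ≤ 3 * (1 + 7 * S₀ * κ ^ 2 / (8 * Real.pi ^ 2 * l)) * (Real.exp c * Real.exp (-(c * r ^ 2 * ((W₁.phase i).τ / 2)))) *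
          ‖u (W₁.start i + (W₁.phase i).τ / 4)‖ ^ 2 :=
        mul_le_mul_of_nonneg_right (mul_le_mul_of_nonneg_left hexp hA) (sq_nonneg _)
    _ = _ := by ring

end Summit.AnomalousDissipation.AnomalousDissipation.Theorems.SolenoidalFractalHomogenisation.LagrangianStep.Sideband

end
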